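import Summits.BirchSwinnertonDyer.Rank1Residual.F1Sign2.DeepTwistLawsAtTwo
import HarnessLib

/-!
# Cell `bsd-f1-sign2`, DESC-§23 riders 7–8: THE `b`-UNIT-CHART TAMAGAWA LAWS OF THE DEEP TWIST (-desc g15, MEMO-desc §23-add3 riders 6–8; CANDIDATES-delta DESC v23.9, v23.10)

TYPER FILING (cell `bsd-f1-sign2`, seat `-ty` g10; -desc g15 filing ask D-desc-48 «file after REF1 (D-desc-47)»: 4 carriers and rows + 2 glue lemmas of
`MEMO-desc-data/g15/lean/SketchG15BUnit.lean` 4db6b37f0a04371d (rc 0 · 0 · 0 · 0; BC7 3/3 CLEAN)): the sketch body VERBATIM — same flat namespace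
`…Rank1Residual.F1Sign2`, one import (the in-tree sibling `F1Sign2.DeepTwistLawsAtTwo`, p640583: carriers `IsTowerStepGenerator`, `deepTwist`,
`discHilbertSymbolTwo`).  Decls: carriers `HasBUnitChartOfDepthAtTwo` (a `ℚ₂`-model `y² = x(x² + ax + b)`, `b` a unit, `a/2` integral,
`v₂((a/2)² − b) ≥ μ`), `HasDeepBUnitChartAtTwo` (`μ = 4`); rows (TC♭-deep) `DeepBUnitChartTamagawaLawAtTwo` (rider 7: `c_v(W ⊗ η_{k+1}) = 3 + (Δ_W, 2)₂`
on the deep `b`-unit chart, every `k ≥ 1`, PROVED IN WORDS), (TC♭-two) `BUnitChartTamagawaTwoLawAtTwo` (rider 8(A): the `c = 2` half, shallow charts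
included, `2^k μ ≥ 4`, `(Δ_W, 2)₂ = −1`, PROVED IN WORDS); glue `hasDeepBUnitChartAtTwo_iff` (`Iff.rfl`), `HasBUnitChartOfDepthAtTwo.mono` (PROVED).
Typer edits = this header and the REF1, REF2 sentences.  Nothing is asserted: `def … : Prop` only.
Census = BC5 WITNESS: kit j309889 (`tw4-all.out` 51c8cac051524caa; PARI `elllocalred` over `ℚ₂(√2)`, `ℚ₂(β₂)` with `δ = 2 + √2`, `2 + β₂`) ×
`an23/a24.py` 3c646045d6221b91: (TC♭-deep) 796/796 cells `(W, k)`, `k = 1, 2`; whole `b`-unit chart 1 723/1 723 at `k = 2`, failures only at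
`k = 1`, `μ₀ ≤ 1` (`f₂ ≥ 5`); (TC♭-two) `k = 2`: 457/457 (`μ₀ ≥ 1`), `k = 1`: 402/402 (`μ₀ ≥ 2`); excluded cells `(k, μ₀) = (1, 1)` 24/55 fail,
`μ₀ = 0` 203/349 fail at `k = 1`, 0/349 at `k = 2`.
REF1-AUDIT §120 (refuter-bsd-f1-sign2-ref1 g11, 2026-08-28T15:22:50Z; evidence `HOME/REF1-data/b120/` — Probe120.lean 2ab05e88563c80c8, replay120.py
dd4a691f2d07a8e8, kit j311235 `r120-all` 9e0bc350e08bbe75, j311352 `r120k0-all` af9cea3f5f819d4a; gate D-desc-48 CLEARED: file the 4 + 2 decls of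
4db6b37f0a04371d VERBATIM): «REF1 §120 (refuter-bsd-f1-sign2-ref1 g11, 2026-08-28): SketchG15BUnit 4db6b37f0a04371d farm rc 0·0·0·0; carriers junk-free
(singular chart excluded by `IsElliptic`), non-vacuous in Lean (`W₁₇ = ⟨0,2,0,17,0⟩`: `HasDeepBUnitChartAtTwo W₁₇`, `IsElliptic`, sorry-free); rider 7
(R-deep) and rider 8 (A) CERTIFIED step by step (T2Φ (i)(iii)(iv) + rider-6 criterion [§117]; `[dθ − a′] = [−a′]·{1,[5]}` θ-free for `λ ≥ 2e`
incl. `1 + 4z ∈ 5K^{×2}` for unit `z`, `k = 𝔽₂`; `(δ,−5)_K = −1` vs `(ℚ₂^×, −5)_K = 1` by the projection formula, `[K:ℚ₂]` even; units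
`θ₀ = δ/2s`, `θ₀ρ`, `θ₀ + π^{3e−1}`, `θ₀ρ + π^{3e−1}` with `θ² + 1 ∈ {1,−1,5,−5}·δK^{×2}`, `v(s) = 1 − e`, `v(z) = 2e`; conductor of
`ℚ₂(ζ_{2^{k+2}})/ℚ₂(ζ_{2^{k+2}})⁺` = `𝔭²` by the discriminant tower) ⟹ `DeepBUnitChartTamagawaLawAtTwo` and `BUnitChartTamagawaTwoLawAtTwo`
THEOREM-GRADE IN SUBSTANCE; `1 ≤ k` load-bearing (k = 0: 228/600 resp. 96/240 failures, j311352); no additivity hypothesis needed (j311235: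
1 350/1 350 (R), 815/815 (A) on 950 curves incl. 180 multiplicative, 60 good at 2, layers k = 1,2,3); census replay 802/802, 457/457, 402/402,
(Δ,2)₂ = PARI 8 000/8 000; KILLED none.»  Typer uptake: r5 — both rows filed as PLAIN support `def`s («PROVED IN WORDS … REF1 §120 certified»,
like `DeepTwistConductorLawAtTwo`), no `@[conjecture]`; r1 — rows kept WITHOUT `4 ∣ N_W` or an `f₂`-window (proof reduction-type-free); r2 —
`1 ≤ k` stays; r3 (engine-dependent census counts 796 vs 802, 1 723 vs 1 726) and r4 (optional TYPE companion row `I*_{2^k(8 − v₂ j_W)}`) are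
-desc's calls, append-only if typed.
REF2-PLACEMENT v32-add1 §A5 (refuter-bsd-f1-sign2-ref2 g32, 2026-08-28T14:56:12Z; `HOME/REF2-PLACEMENT-v32-add1.md` cfb4bcaac107fd23): «(R-deep)
"b-unit chart, a₀ even, μ₀ = v₂(a′² − b₀) ≥ 4: c(W ⊗ η_{k+1}/L_k) = 3 + (Δ_W, 2)₂, all k ≥ 1": STATEMENT NOT IN PRINT (the same
Dokchitser–Dokchitser 2015 Table 1 open cell; no table over L_k), METHOD KNOWN (Tate Step 7, φ̂-Kummer image criterion + Hilbert symbols + explicit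
units) ⇒ COMPUTABLE-FROM-PRINT, VARIANT; beyond-print no, small.  DISJOINT from -imc's §10.80 family (there the 2-torsion abscissa is odd, off
the a₀-even chart) — the two words-proofs together shrink (R), S3 to "b-unit chart, μ₀ ≤ 3".»  Rider 8 (A): same placement (REF1 §120 cc -ref2 g33: «placement v32-add1 §A5 unchanged»).
[cite: SilvermanATAEC1994, IV.9.4 Step 7] [cite: DokchitserDokchitser2011, Thm. 5]
PARTITION: none moved (frontier tier); beyond-print theorem: no (explicit local computations; REF2 COMPUTABLE-FROM-PRINT).  BSD is not proved by
any of this.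
bears_on: F1Sign2 leaf (IMC-LTS `LocalTowerSignLawAtTwo` ⟸ (T_n) ⟸ (TY)(b) Tamagawa clause of `DeepTwistNeronTypeLawAtTwo`; -imc (R) residual
`LocalTowerSignLawAtTwoCondThreeMPosRam`, S3); asks D-desc-47 (REF1), D-desc-48 (-ty, this file).

## The sketch's own summary (verbatim)

# Cell `bsd-f1-sign2`, lens `-desc` g15 (MEMO-desc §23-add3 riders 6–7): the `b`-UNIT-CHART Tamagawa law of the deep twist,
DEEP SUB-CASE — a THEOREM in words (rider 7), typed as a target over the tree carriers of `F1Sign2/DeepTwistLawsAtTwo.lean`.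

Setting (rider 7).  `W/ℚ` with a `ℚ₂`-model `y² = x(x² + a x + b)`, `b ∈ ℤ₂^×`, `a ∈ 2ℤ₂`, and `μ₀ := v₂((a/2)² − b) ≥ 4`
(equivalently `v₂(j_W) ≤ 2` on this chart); `κ` the cyclotomic `ℤ₂`-extension, `k ≥ 1`, `δ` a step generator of `ℚ_{k+1}/ℚ_k`
(`δ ≡ 2 + ζ_{2^{k+2}} + ζ_{2^{k+2}}⁻¹ = N(1 + ζ_{2^{k+2}})` mod squares), `v ∣ 2` the prime of `ℚ_k`.  CLAIM: `c_v(W ⊗ η_{k+1}) = 3 + (Δ_W, 2)₂`.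
No deepness / additivity hypothesis is needed in this sub-case.  PROOF (rider 6 criterion `c = 4 ⟺ ∃ ξ ∈ O^× : ξ(ξ² + aξ + b) ∈ δ·K^{×2}`
+ rider 4 (T2Φ) for `(a/2)² − b ∈ K^{×2} ∪ 5K^{×2}` + for `b − (a/2)² = u d²`, `u ∈ {1, 5}`, `v_K(d) = 2^{k-1}μ₀ ≥ 2e`: the class of
`dθ − a/2` is `(−a/2)·{1,5}` for every unit `θ`, so `u = 5` is impossible by `(·, −5)_K` (`(δ,−5)_K = −1`, rationals have symbol `+1` as
`[ℚ_k:ℚ₂]` is even) and `u = 1` is solved by `θ_c ∈ {θ₀, θ₀ρ, θ₀ + π^{3e−1}, θ₀ρ + π^{3e−1}}`, `θ₀ = δ/(2s)`, `ζ = β/2 + is`, `ρ² = 1 − 8/δ`,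
with `θ_c² + 1 ∈ cδK^{×2}` for `c = 1, −1, 5, −5`).  Census = BC5 witness: kit j309889 (`tw4-all.out` 51c8cac051524caa, PARI `elllocalred`
over `ℚ₂(√2)`, `ℚ₂(β₂)` with `δ = 2 + √2`, `2 + β₂`) × `an23/a24.py`: 796/796 cells `(W, k)`, `k = 1, 2`, in scope, 0 exceptions
(all 1 723 `b`-unit-chart curves: law holds at `k = 2` for every `μ₀`; at `k = 1` it fails only for `μ₀ ∈ {0, 1}`, all with `f₂ ≥ 5`).
PARTITION: none moved; beyond-print theorem: no (an explicit Tate/Hensel computation; REF2: COMPUTABLE FROM PRINT).  Nothing is asserted.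
-/

noncomputable section

open scoped Classical NumberField

open WeierstrassCurve Literature.NumberTheory.EllipticCurves Literature.NumberTheory.DiophantineGeometry
open Literature.NumberTheory.EllipticCurves.Rank1Residual ZpExtension IsDedekindDomain NumberField

namespace Summit.BirchSwinnertonDyer.Rank1Residual.F1Sign2

/-- `W/ℚ` has a `b`-UNIT CHART OF DEPTH `μ` at `2`: a `ℚ₂`-isomorphic model `y² = x(x² + a x + b)` with `b ∈ ℤ₂^×`, `a/2 ∈ ℤ₂`
and `v₂((a/2)² − b) ≥ μ` (so `W` has a `ℚ₂`-rational `2`-torsion abscissa, `Δ_W ≡ (a/2)² − b` mod `ℚ₂^{×2}`, and on this chart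
`v₂(j_W) = 6 − v₂((a/2)² − b)`). -/
def HasBUnitChartOfDepthAtTwo (W : WeierstrassCurve ℚ) (μ : ℕ) : Prop :=
  ∃ (C : VariableChange ℚ_[2]) (a b : ℚ_[2]),
    C • (W.baseChange ℚ_[2]) = (⟨0, a, 0, b, 0⟩ : WeierstrassCurve ℚ_[2]) ∧
      ‖b‖ = 1 ∧ ‖a / 2‖ ≤ 1 ∧ ‖(a / 2) ^ 2 - b‖ ≤ (2 : ℝ)⁻¹ ^ μ

/-- `W/ℚ` has a DEEP `b`-unit chart at `2`: depth `μ = 4`, i.e. `v₂((a/2)² − b) ≥ 4` (⟺ `v₂(j_W) ≤ 2` on the chart; forces `a/2` odd). -/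
def HasDeepBUnitChartAtTwo (W : WeierstrassCurve ℚ) : Prop := HasBUnitChartOfDepthAtTwo W 4

/-- **(TC♭-deep) `b`-unit-chart Tamagawa law of the deep twist, deep sub-case** — PROVED IN WORDS (MEMO-desc §23-add3 rider 7):
for `W/ℚ` elliptic with a deep `b`-unit chart at `2`, the cyclotomic `κ`, `k ≥ 1`, a step generator `δ` and `v ∣ 2` of `ℚ_k`:
`c_v(W ⊗ η_{k+1}) = 3 + (Δ_W, 2)₂`.  This is clause (b) (Tamagawa part) of `DeepTwistNeronTypeLawAtTwo` on the sub-family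
`v₂(j_W) ≤ 2` of the `b`-unit chart, freed of the hypotheses `4 ∣ N_W`, `3 ≤ f₂ ≤ 2k + 2`.  Why it might fail: only if the words-proof
has a gap (the `λ = 2e` class computation `1 + 4z ∈ 5K^{×2}` for unit `z`, residue field `𝔽₂`).  Census: 796/796 tower cells (kit j309889 × a24.py).
REF1 §120: THEOREM-GRADE IN SUBSTANCE — PROVED IN WORDS (MEMO-desc §23-add3 rider 7; REF1 §120 certified step by step, incl. the `λ = 2e` class
computation); filed as a plain support `def` (r5, like `DeepTwistConductorLawAtTwo`); r1: no `4 ∣ N_W` or `f₂`-window needed (proof reduction-type-free;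
REF1 kit j311235: 1 350/1 350 rows incl. 180 multiplicative and 60 good `W` at `2`, layers `k = 1, 2, 3`); r2: `1 ≤ k` is load-bearing (`k = 0`:
228/600 failures, j311352).  REF2 v32-add1 §A5.1: STATEMENT NOT IN PRINT, METHOD KNOWN ⇒ COMPUTABLE-FROM-PRINT, VARIANT. -/
def DeepBUnitChartTamagawaLawAtTwo : Prop :=
  ∀ (W : WeierstrassCurve ℚ) [W.IsElliptic], HasDeepBUnitChartAtTwo W →
    ∀ (κ : ZpExtension ℚ 2), κ.IsCyclotomic → ∀ k : ℕ, 1 ≤ k →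
      ∀ δ : ↥(κ.layer k), IsTowerStepGenerator κ k δ →
        haveI : FiniteDimensional ℚ ↥(κ.layer k) := κ.finiteDimensional_layer_holds k
        haveI : NumberField ↥(κ.layer k) := NumberField.of_module_finite ℚ ↥(κ.layer k)
        ∀ v : HeightOneSpectrum (𝓞 ↥(κ.layer k)), (2 : 𝓞 ↥(κ.layer k)) ∈ v.asIdeal →
          ((deepTwist W κ k δ).tamagawaNumberAt v : ℤ) = 3 + discHilbertSymbolTwo W

/-- **(TC♭-two) the `c = 2` half of the `b`-unit-chart Tamagawa law, shallow charts included** — PROVED IN WORDS (MEMO-desc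
§23-add3 rider 8): for `W/ℚ` elliptic with a `b`-unit chart of depth `μ` at `2`, `2^k·μ ≥ 4` (i.e. `μ ≥ 1` when `k ≥ 2`, `μ ≥ 2`
when `k = 1`), and `(Δ_W, 2)₂ = −1`: `c_v(W ⊗ η_{k+1}) = 2` for every step generator.  Proof: `Δ_W ∈ 5K^{×2}` ⇒ T2Φ (iv);
`Δ_W ∈ −5K^{×2}` ⇒ the rider-6 criterion needs `(dθ − a/2)(θ² + 5) ∈ δK^{×2}` with `v(dθ) = 2^{k−1}μ ≥ 2`, impossible since
`(·, −1)_K` has conductor `𝔭²` on every layer `K = ℚ₂(ζ_{2^{k+2}})⁺` (different of `ℚ₂(ζ_{2^{k+2}})/K` is `𝔭²`) while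
`(δ, −5)_K = −1`.  Census (kit j309889 × a24.py, `b`-unit chart, `(Δ_W,2)₂ = −1`): `k = 2`: 457/457 cells with `μ₀ ≥ 1`;
`k = 1`: 402/402 cells with `μ₀ ≥ 2`; the excluded cells `(k, μ₀) = (1, 1)` fail 24/55 and `μ₀ = 0` fails 203/349 at `k = 1` (0/349 at `k = 2`, all deep).
REF1 §120: THEOREM-GRADE IN SUBSTANCE — PROVED IN WORDS (MEMO-desc §23-add3 rider 8 (A); REF1 §120 certified: conductor `𝔭²` of
`ℚ₂(ζ_{2^{k+2}})/ℚ₂(ζ_{2^{k+2}})⁺` by the discriminant tower, `(δ, −5)_K = −1`); filed as a plain support `def` (r5); r1: reduction-type-free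
(j311235: 815/815 rows incl. multiplicative and good `W` at `2`); r2: the hypothesis `4 ≤ 2^k·μ` with `1 ≤ k` is load-bearing (`k = 0`: 96/240
failures, j311352).  REF2: as rider 7 (COMPUTABLE-FROM-PRINT, VARIANT). -/
def BUnitChartTamagawaTwoLawAtTwo : Prop :=
  ∀ (W : WeierstrassCurve ℚ) [W.IsElliptic] (μ : ℕ), HasBUnitChartOfDepthAtTwo W μ → discHilbertSymbolTwo W = -1 →
    ∀ (κ : ZpExtension ℚ 2), κ.IsCyclotomic → ∀ k : ℕ, 1 ≤ k → 4 ≤ 2 ^ k * μ →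
      ∀ δ : ↥(κ.layer k), IsTowerStepGenerator κ k δ →
        haveI : FiniteDimensional ℚ ↥(κ.layer k) := κ.finiteDimensional_layer_holds k
        haveI : NumberField ↥(κ.layer k) := NumberField.of_module_finite ℚ ↥(κ.layer k)
        ∀ v : HeightOneSpectrum (𝓞 ↥(κ.layer k)), (2 : 𝓞 ↥(κ.layer k)) ∈ v.asIdeal →
          (deepTwist W κ k δ).tamagawaNumberAt v = 2

/-- Glue (kernel-checked): the deep chart is the depth-4 chart. -/
theorem hasDeepBUnitChartAtTwo_iff (W : WeierstrassCurve ℚ) :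
    HasDeepBUnitChartAtTwo W ↔ HasBUnitChartOfDepthAtTwo W 4 := Iff.rfl

/-- Glue (kernel-checked): depth is monotone — a deeper chart is a chart of every smaller depth. -/
theorem HasBUnitChartOfDepthAtTwo.mono {W : WeierstrassCurve ℚ} {μ ν : ℕ} (h : HasBUnitChartOfDepthAtTwo W μ)
    (hνμ : ν ≤ μ) : HasBUnitChartOfDepthAtTwo W ν := by
  obtain ⟨C, a, b, hC, hb, ha, hD⟩ := h
  refine ⟨C, a, b, hC, hb, ha, hD.trans ?_⟩
  exact pow_le_pow_of_le_one (by norm_num) (by norm_num) hνμ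

end Summit.BirchSwinnertonDyer.Rank1Residual.F1Sign2

end
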